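import Summits.BirchSwinnertonDyer.BirchSwinnertonDyer.Theorems.PrintCFramBottomClassIndexLawFiveLeSelmerDevissageLocalCriterionPoint
import Summits.BirchSwinnertonDyer.BirchSwinnertonDyer.Theorems.PrintCFramBottomClassIndexLawFiveLeSelmerDevissageLocalCriterionIsogenyClass
import Literature.NumberTheory.EllipticCurves.PointDivisibilityProofs
import HarnessLib

/-!
# Route `PrintCFram`, crux C2 `BottomClassIndexLawFiveLe` (stmt-BirchSwinnertonDyer-20372), line
# `eisenstein-resource-bdp-line` (registry v19/v20): **THE LOCAL KUMMER CRITERION ON ALGEBRAIC POINTS** — for a RATIONAL point the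
# `Φ`-adapted-root condition at `v` needs no local points at all: it is a statement about `W(ℚ̄)` and the decomposition group `D_v`
# (cell `bsd-print-cfram`, width seat `bsd-line-cfram-p1-w6` g4; helper `--supports` 20372; 0 defs, 0 facts, 0 sorry)

HONEST FRAMING. Nothing about BSD is proved here and no stub is closed. Sequel of `…SelmerDevissageLocalCriterion{,Level,Point,Isogeny,IsogenyClass}`.
For a rational point `P ∈ W(ℚ)` the condition «`P` has a `Φ`-adapted `p`-th root at `v`» (`∃ R ∈ W(K̄_v)`, `p • R = ι P`, `σ • R − R ∈ ι(Φ)` on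
`Γ_v`) was phrased in `W(K̄_v) = localPoints`; here it is brought back to `W(ℚ̄)`:

* §1 **`exists_adaptedRoot_iff_exists_geom_root`** — for `P ∈ W(ℚ)` and any finite place `v`: `P` has a `Φ`-adapted `p`-th root at `v` iff
  `P` has an ALGEBRAIC `p`-th root `R₁ ∈ W(ℚ̄)` whose Kummer cocycle is `Φ`-valued ON THE DECOMPOSITION GROUP `D_v = decomp v`
  (`∀ τ ∈ D_v, τ • R₁ − R₁ ∈ Φ`). (All `p`-th roots of an algebraic point are algebraic: two roots differ by `p`-torsion, which is algebraic,
  `exists_geomTorsion_pointsMap_eq`; and `D_v` is the image of `Γ_v`.)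
* §2 **`exists_adaptedRoot_iff_exists_decomp_fixed_preimage`** — with a dual pair `φ : W → W'`, `ψ : W' → W` (`ψ ∘ φ = [p]`,
  `Φ = ker φ|_{W[p]}`): `P` has a `Φ`-adapted root at `v` iff **`P ∈ ψ(W'(ℚ̄)^{D_v})`** (`∃ Q' ∈ W'(ℚ̄)`, `ψ Q' = ι P`, `τ • Q' = Q'` for
  `τ ∈ D_v`) — the promised reading «`P ∈ φ̂W'(ℚ_v)`», now a kernel statement (the `D_v`-fixed algebraic points of `W'` standing in for
  `W'(ℚ_v) ∩ W'(ℚ̄)`).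
* §3 the certificate of `…LocalCriterionPoint` §3 and the see-saw of `…IsogenyClass` §2 in this currency:
  **`bsdp_iff_shaAnUnit_of_odd_line_of_not_mem_dual_image`** — class member, `‖B_{1,ψ⁻¹}‖ = p⁻¹`, odd line `Φ₀ = ker φ|_{W[p]}`, generator `g`
  of LEVEL `0` with **`g ∉ ψ(W'(ℚ̄)^{D_p})`** ⟹ `BSDp W p ↔ p ∤ #Ш_an(W)` (+ `Ш(W)[p] = 0`, `sha_noPTorsion_…`), mod MW Thm 2 / CT / GZK /
  `r_an = 1`; **`exists_partner_generator_eq_pointHom_add_torsion_of_not_mem_dual_image`** — `g ∉ ψ(W'(ℚ̄)^{D_v})` for one `v` ⟹ the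
  partner's generator is `f(Q)` modulo torsion.

THEOREMS ONLY; no definition, no named fact, no `sorry`. BSD is not proved by any of this; no summit statement is proved by this seat. References:
[SilvermanAEC2009] VIII.§2, X.§4 (diagram (**), Rem. 4.7, Ex. 4.8); [NeukirchANT1999] II (9.6); seat notes w6g4.
-/

set_option autoImplicit false
-- `…BirchSwinnertonDyer.BirchSwinnertonDyer.Theorems…` is the problem's mandated namespace (D-0017).
set_option linter.dupNamespace false

noncomputable section

open scoped Classical

namespace Summit.BirchSwinnertonDyer.BirchSwinnertonDyer.Theorems.PrintCFram.SelmerCount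

open NumberField IsDedekindDomain Field WeierstrassCurve DirichletCharacter
open Literature.NumberTheory.NumberFields Literature.NumberTheory.EllipticCurves Literature.NumberTheory.GaloisRepresentations
  Literature.NumberTheory.EllipticCurves.GreenbergSelmer Literature.NumberTheory.EllipticCurves.Rank1Residual
  Literature.NumberTheory.EllipticCurves.KrizLi2019
open Summit.BirchSwinnertonDyer.Rank1Residual Summit.BirchSwinnertonDyer.Rank1Residual.X2.ResidualDevissageModules
open Summit.BirchSwinnertonDyer.BirchSwinnertonDyer.Theorems.PrintCFram.LevelDictionary

variable {p : ℕ} [hp : Fact p.Prime]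

/-! ## §1 Adapted roots of a rational point are algebraic: the `D_v`-form -/

section Geom

variable (W : WeierstrassCurve ℚ) [W.IsElliptic] (v : HeightOneSpectrum (𝓞 ℚ))
  (Φ : StableSubgroup (absoluteGaloisGroup ℚ) (geomTorsion W (p : ℤ)))

/-- **A rational point has a `Φ`-adapted `p`-th root at `v` iff it has an ALGEBRAIC `p`-th root whose Kummer cocycle is `Φ`-valued on the
decomposition group `D_v`.** (`→`: an algebraic root `R₀` exists, `[p]` being onto `W(ℚ̄)`; the given local root differs from `ι R₀` by a
`p`-torsion point, algebraic; `D_v = res(Γ_v)`. `←`: push the algebraic root into `W(K̄_v)`.) [cite: SilvermanAEC2009, VIII.§2 and X.§4 (Rem. 4.7)]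
[cite: NeukirchANT1999, Ch. II §9 Prop. (9.6)] -/
theorem exists_adaptedRoot_iff_exists_geom_root (P : W.toAffine.Point) :
    (∃ R : localPoints W (v.adicCompletion ℚ),
        (p : ℤ) • R = pointsMap W (v.adicCompletion ℚ) (toGeomPoints W P) ∧
        ∀ σ : absoluteGaloisGroup (v.adicCompletion ℚ), ∃ t ∈ Φ.toAddSubgroup,
          σ • R - R = pointsMap W (v.adicCompletion ℚ) (t : geomPoints W)) ↔
    ∃ R₁ : geomPoints W, (p : ℤ) • R₁ = toGeomPoints W P ∧
        ∀ τ ∈ decomp v, ∃ t ∈ Φ.toAddSubgroup, τ • R₁ - R₁ = (t : geomPoints W) := by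
  have hp0 : (p : ℤ) ≠ 0 := by exact_mod_cast hp.out.ne_zero
  constructor
  · rintro ⟨R, hR, hRΦ⟩
    obtain ⟨R₀, hR₀⟩ := W.zsmul_geomPoints_surjective_holds hp0 (toGeomPoints W P)
    simp only at hR₀
    -- the local root differs from `ι R₀` by an algebraic `p`-torsion point
    obtain ⟨t₀, ht₀⟩ := exists_geomTorsion_pointsMap_eq W v (T := R - pointsMap W (v.adicCompletion ℚ) R₀)
      (by rw [zsmul_sub, hR, ← map_zsmul, hR₀, sub_self])
    refine ⟨R₀ + (t₀ : geomPoints W), ?_, fun τ hτ ↦ ?_⟩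
    · rw [zsmul_add, hR₀, (mem_geomTorsion_iff W (p : ℤ) _).mp t₀.2, add_zero]
    · obtain ⟨σ, rfl⟩ := (mem_decomp_iff v τ).1 hτ
      obtain ⟨t, htΦ, ht⟩ := hRΦ σ
      refine ⟨t, htΦ, ?_⟩
      apply pointsMapOfEmb_injective W (closureEmb (K := ℚ) (v.adicCompletion ℚ))
      change pointsMap W (v.adicCompletion ℚ) _ = pointsMap W (v.adicCompletion ℚ) _
      rw [← ht, map_sub, ← resGal_eq_absGaloisRestrict, pointsMap_smul, map_add, ht₀, add_sub_cancel]
  · rintro ⟨R₁, hR₁, hR₁Φ⟩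
    refine ⟨pointsMap W (v.adicCompletion ℚ) R₁, by rw [← map_zsmul, hR₁], fun σ ↦ ?_⟩
    obtain ⟨t, htΦ, ht⟩ := hR₁Φ (resGal (K := ℚ) (v.adicCompletion ℚ) σ)
      ((mem_decomp_iff v _).2 ⟨σ, by rw [resGal_eq_absGaloisRestrict]⟩)
    exact ⟨t, htΦ, by rw [← pointsMap_smul, ← map_sub, ht]⟩

end Geom

/-! ## §2 With the isogeny: `P ∈ ψ(W'(ℚ̄)^{D_v})` -/

section Dual

variable {W W' : WeierstrassCurve ℚ} [W.IsElliptic] [W'.IsElliptic]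

/-- **`P` has a `ker φ`-adapted root at `v` iff `P ∈ ψ(W'(ℚ̄)^{D_v})`.** For `ℚ`-isogenies `φ : W → W'`, `ψ : W' → W` with `ψ (φ R) = p • R`
and `Φ = ker φ|_{W[p]}`: a rational point `P` has a `Φ`-adapted `p`-th root at `v` iff `ι P = ψ Q'` for some `Q' ∈ W'(ℚ̄)` FIXED BY `D_v`
(`Q' = φ R₁` for the algebraic root of §1; conversely any `φ`-preimage of `Q'` is such a root: `τR₁ − R₁ ∈ ker φ ∩ W[p] = Φ`).
[cite: SilvermanAEC2009, III.4 Thm. 4.8 and X.§4 (Rem. 4.7, Ex. 4.8)] -/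
theorem exists_adaptedRoot_iff_exists_decomp_fixed_preimage (φ : Isogeny W W') (ψ : Isogeny W' W)
    (hdual : ∀ R : geomPoints W, ψ (φ R) = (p : ℤ) • R)
    (Φ : StableSubgroup (absoluteGaloisGroup ℚ) (geomTorsion W (p : ℤ)))
    (hker : ∀ t : geomTorsion W (p : ℤ), t ∈ Φ.toAddSubgroup ↔ φ (t : geomPoints W) = 0)
    (v : HeightOneSpectrum (𝓞 ℚ)) (P : W.toAffine.Point) :
    (∃ R : localPoints W (v.adicCompletion ℚ),
        (p : ℤ) • R = pointsMap W (v.adicCompletion ℚ) (toGeomPoints W P) ∧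
        ∀ σ : absoluteGaloisGroup (v.adicCompletion ℚ), ∃ t ∈ Φ.toAddSubgroup,
          σ • R - R = pointsMap W (v.adicCompletion ℚ) (t : geomPoints W)) ↔
    ∃ Q' : geomPoints W', ψ Q' = toGeomPoints W P ∧ ∀ τ ∈ decomp v, τ • Q' = Q' := by
  rw [exists_adaptedRoot_iff_exists_geom_root W v Φ P]
  constructor
  · rintro ⟨R₁, hR₁, hR₁Φ⟩
    refine ⟨φ R₁, by rw [hdual, hR₁], fun τ hτ ↦ ?_⟩
    obtain ⟨t, htΦ, ht⟩ := hR₁Φ τ hτ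
    have h := congrArg φ ht
    rw [map_sub, φ.map_smul, (hker t).mp htΦ, sub_eq_zero] at h
    exact h
  · rintro ⟨Q', hQ', hfix⟩
    obtain ⟨R₁, hR₁⟩ := φ.surjective Q'
    refine ⟨R₁, by rw [← hdual, hR₁, hQ'], fun τ hτ ↦ ?_⟩
    have htors : (p : ℤ) • (τ • R₁ - R₁) = 0 := by
      rw [zsmul_sub, smul_comm, ← hdual R₁, hR₁, hQ', smul_toGeomPoints, sub_self]
    have hkerτ : φ (τ • R₁ - R₁) = 0 := by rw [map_sub, φ.map_smul, hR₁, hfix τ hτ, sub_self]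
    exact ⟨⟨τ • R₁ - R₁, (mem_geomTorsion_iff W (p : ℤ) _).mpr htors⟩, (hker _).mpr hkerτ, rfl⟩

end Dual

/-! ## §3 The certificate and the see-saw in the `D_v`-currency -/

section Readings

variable {W W' : WeierstrassCurve ℚ} [W.IsElliptic] [W'.IsElliptic] [W.IsGloballyMinimal]

/-- **ODD kernel line, LEVEL-`0` generator `g ∉ ψ(W'(ℚ̄)^{D_p})`, `‖B_{1,ψ⁻¹}‖ = p⁻¹` ⟹ `Ш(W)[p] = 0`** (+ hMW, hCT, hGZK, `r_an = 1`):
`sha_noPTorsion_of_odd_line_of_not_adaptedRoot` with §2. [cite: MazurWiles1984, Thm. 2 (p. 214)] [cite: Cassels1962ArithmeticIV] -/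
theorem sha_noPTorsion_of_odd_line_of_not_mem_dual_image (hMW : MazurWiles1984.thm2_card_oddChiClassGroup_eq_bernoulli)
    (hCT : exists_casselsTate_pairing (K := ℚ)) (hGZK : rank_eq_analyticRank_of_analyticRank_le_one)
    (hCM : W.HasCM) (hram : CMRamified W p) (h5 : 5 ≤ p) (hr : W.analyticRank = 1)
    {f : ℕ} [NeZero f] (χ : DirichletCharacter ℚ_[p] f) (ω : DirichletCharacter ℚ_[p] p)
    (hχ : χ.Odd) (hω : IsTeichmullerCharacter ω)
    (hss : ∀ ℓ : ℕ, ℓ.Prime → ¬ (ℓ ∣ p * W.conductorNorm ℤ) →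
      ‖((W.LFunction ℓ : ℤ) : ℚ_[p]) - (χ (ℓ : ZMod f) + χ⁻¹ (ℓ : ZMod f) * ω (ℓ : ZMod p))‖ < 1)
    (hB : ‖bernoulliOnePrim χ⁻¹‖ = (p : ℝ)⁻¹)
    {v : HeightOneSpectrum (𝓞 ℚ)} (hpv : ((p : ℕ) : 𝓞 ℚ) ∈ v.asIdeal)
    (φ : Isogeny W W') (ψ : Isogeny W' W) (hdual : ∀ R : geomPoints W, ψ (φ R) = (p : ℤ) • R)
    (Φ₀ : StableSubgroup (absoluteGaloisGroup ℚ) (geomTorsion W (p : ℤ))) (hcard₀ : Nat.card Φ₀.Sub = p)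
    (hker : ∀ t : geomTorsion W (p : ℤ), t ∈ Φ₀.toAddSubgroup ↔ φ (t : geomPoints W) = 0)
    (hodd : ∀ c : absoluteGaloisGroup ℚ, IsComplexConjugation (Rat.castHom ℝ) c → ∀ x : Φ₀.Sub, c • x = -x)
    (g : W.toAffine.Point) (hlev : ∀ Q : (W.baseChange ℚ_[p]).toAffine.Point, p • Q ≠ W.toPadicPoint p g)
    (hng : ¬ ∃ Q' : geomPoints W', ψ Q' = toGeomPoints W g ∧ ∀ τ ∈ decomp v, τ • Q' = Q') :
    ∀ x : W.sha, (p : ℤ) • x = 0 → x = 0 :=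
  sha_noPTorsion_of_odd_line_of_not_adaptedRoot W hMW hCT hGZK hCM hram h5 hr χ ω hχ hω hss hB hpv Φ₀ hcard₀ hodd g hlev
    (fun h ↦ hng ((exists_adaptedRoot_iff_exists_decomp_fixed_preimage φ ψ hdual Φ₀ hker v g).mp h))

/-- **ODD kernel line, LEVEL-`0` generator `g ∉ ψ(W'(ℚ̄)^{D_p})`, `‖B_{1,ψ⁻¹}‖ = p⁻¹` ⟹ (`BSDp W p ↔ p ∤ #Ш_an(W)`)** (+ hMW, hCT, hGZK,
`r_an = 1`). [cite: MazurWiles1984, Thm. 2 (p. 214)] [cite: Cassels1962ArithmeticIV] [cite: Miller2011LMS, Def. 1.1] -/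
theorem bsdp_iff_shaAnUnit_of_odd_line_of_not_mem_dual_image (hMW : MazurWiles1984.thm2_card_oddChiClassGroup_eq_bernoulli)
    (hCT : exists_casselsTate_pairing (K := ℚ)) (hGZK : rank_eq_analyticRank_of_analyticRank_le_one)
    (hCM : W.HasCM) (hram : CMRamified W p) (h5 : 5 ≤ p) (hr : W.analyticRank = 1)
    {f : ℕ} [NeZero f] (χ : DirichletCharacter ℚ_[p] f) (ω : DirichletCharacter ℚ_[p] p)
    (hχ : χ.Odd) (hω : IsTeichmullerCharacter ω)
    (hss : ∀ ℓ : ℕ, ℓ.Prime → ¬ (ℓ ∣ p * W.conductorNorm ℤ) →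
      ‖((W.LFunction ℓ : ℤ) : ℚ_[p]) - (χ (ℓ : ZMod f) + χ⁻¹ (ℓ : ZMod f) * ω (ℓ : ZMod p))‖ < 1)
    (hB : ‖bernoulliOnePrim χ⁻¹‖ = (p : ℝ)⁻¹)
    {v : HeightOneSpectrum (𝓞 ℚ)} (hpv : ((p : ℕ) : 𝓞 ℚ) ∈ v.asIdeal)
    (φ : Isogeny W W') (ψ : Isogeny W' W) (hdual : ∀ R : geomPoints W, ψ (φ R) = (p : ℤ) • R)
    (Φ₀ : StableSubgroup (absoluteGaloisGroup ℚ) (geomTorsion W (p : ℤ))) (hcard₀ : Nat.card Φ₀.Sub = p)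
    (hker : ∀ t : geomTorsion W (p : ℤ), t ∈ Φ₀.toAddSubgroup ↔ φ (t : geomPoints W) = 0)
    (hodd : ∀ c : absoluteGaloisGroup ℚ, IsComplexConjugation (Rat.castHom ℝ) c → ∀ x : Φ₀.Sub, c • x = -x)
    (g : W.toAffine.Point) (hlev : ∀ Q : (W.baseChange ℚ_[p]).toAffine.Point, p • Q ≠ W.toPadicPoint p g)
    (hng : ¬ ∃ Q' : geomPoints W', ψ Q' = toGeomPoints W g ∧ ∀ τ ∈ decomp v, τ • Q' = Q') :
    BSDp W p ↔ ∃ q : ℚ, shaAn W = (q : ℂ) ∧ padicValRat p q = 0 :=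
  bsdp_iff_shaAnUnit_of_odd_line_of_not_adaptedRoot W hMW hCT hGZK hCM hram h5 hr χ ω hχ hω hss hB hpv Φ₀ hcard₀ hodd g hlev
    (fun h ↦ hng ((exists_adaptedRoot_iff_exists_decomp_fixed_preimage φ ψ hdual Φ₀ hker v g).mp h))

omit [W.IsGloballyMinimal] in
/-- **`g ∉ ψ(W'(ℚ̄)^{D_v})` at ONE place ⟹ the partner's generator is `f(Q)` modulo torsion** (see-saw,
`exists_partner_generator_eq_pointHom_add_torsion_of_not_adaptedRoot` with §2; `W(ℚ)` without `p`-torsion).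
[cite: SilvermanAEC2009, III.6.2 and X.§4 (Rem. 4.7, Ex. 4.8)] -/
theorem exists_partner_generator_eq_pointHom_add_torsion_of_not_mem_dual_image (φ : Isogeny W W') (ψ : Isogeny W' W)
    (hdual : ∀ R : geomPoints W, ψ (φ R) = (p : ℤ) • R)
    (f : W.toAffine.Point →+ W'.toAffine.Point) (f' : W'.toAffine.Point →+ W.toAffine.Point)
    (hff' : ∀ P, f' (f P) = p • P) (hf' : ∀ Q', toGeomPoints W (f' Q') = ψ (toGeomPoints W' Q'))
    (Φ : StableSubgroup (absoluteGaloisGroup ℚ) (geomTorsion W (p : ℤ)))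
    (hker : ∀ t : geomTorsion W (p : ℤ), t ∈ Φ.toAddSubgroup ↔ φ (t : geomPoints W) = 0)
    (hnp : ∀ T : W.toAffine.Point, p • T = 0 → T = 0)
    {g : W.toAffine.Point} (hg : ¬ IsOfFinAddOrder g)
    (hgen : ∀ R : W.toAffine.Point, ∃ (k : ℤ) (T : W.toAffine.Point), IsOfFinAddOrder T ∧ R = k • g + T)
    {g' : W'.toAffine.Point} (hg' : ¬ IsOfFinAddOrder g')
    (hgen' : ∀ R : W'.toAffine.Point, ∃ (k : ℤ) (T : W'.toAffine.Point), IsOfFinAddOrder T ∧ R = k • g' + T)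
    (v : HeightOneSpectrum (𝓞 ℚ))
    (hng : ¬ ∃ Q' : geomPoints W', ψ Q' = toGeomPoints W g ∧ ∀ τ ∈ decomp v, τ • Q' = Q') :
    ∃ (Q : W.toAffine.Point) (T' : W'.toAffine.Point), IsOfFinAddOrder T' ∧ g' = f Q + T' :=
  exists_partner_generator_eq_pointHom_add_torsion_of_not_adaptedRoot φ ψ hdual f f' hff' hf' Φ hker hnp hg hgen hg' hgen' v
    (fun h ↦ hng ((exists_adaptedRoot_iff_exists_decomp_fixed_preimage φ ψ hdual Φ hker v g).mp h))

end Readings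

end Summit.BirchSwinnertonDyer.BirchSwinnertonDyer.Theorems.PrintCFram.SelmerCount

end
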